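import Literature.Geometry.Kaehler.ComplexTorusPeriodicAnalyticSet
import Literature.Geometry.Kaehler.HolomorphicChainAddHolds
import Literature.Geometry.GeometricMeasureTheory.CurrentsSlicing
import Mathlib.Analysis.SpecialFunctions.SmoothTransition
import Mathlib.LinearAlgebra.Pi
import HarnessLib

/-!
# Stokes' theorem for a periodic holomorphic chain over a slab fundamental domain

Layer `Literature/Geometry/Kaehler`; lane `lit-hodgefound`, Layer A4, row A4-18 (b) stage (ii)
(`run/shared/lean/pub/lit-hodgefound/SKELETON.md` §P Q58, node N5 of
`lit-hodgefound-p07/Q58-STAGING.md`, Route B, step B1): towards the INTEGRALITY of the periods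
`∫_Z η`, `η ∈ H^{2d}(X, ℤ)`, of a closed analytic subvariety `Z` of a complex torus `X = E/Λ`.

The lift `A = π⁻¹(Z) ⊆ E` of `Z` carries the closed current of integration `[A]`
(`d[A] = 0`: Lelong–Harvey, tree `Harvey1977_boundary_toCurrent_eq_zero_holds`), tested against
COMPACTLY supported forms. The period functional of `Z` integrates over a FUNDAMENTAL DOMAIN of the
lattice; to differentiate it one needs Stokes' theorem for `Λ`-PERIODIC forms over a fundamental
domain. This file proves it, for the sub-lattices `Λ_K = Φ(ℤ^K × 0)` of `Λ = Φ(ℤ^ι)` spanned by a set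
`K` of coordinate directions and their SLAB fundamental domains `{x | x_k ∈ [0, 1) ∀ k ∈ K}`:

* `unitPartition` — the smooth bump `ψ(t) = S(t) − S(t − 1)` (`S` = Mathlib's `Real.smoothTransition`),
  `0 ≤ ψ ≤ 1`, supported in `[0, 2]`, with `Σ_{m ∈ ℤ} ψ(t + m) = 1` (a telescoping sum,
  `sum_unitPartition`);
* `ComplexTorus.latticeVecOn Φ K`, `coordSubLattice Φ K`, `slab Φ K a`,
  `isAddFundamentalDomain_slab` — the sub-lattice of lattice vectors supported in `K` and its slab
  fundamental domains (Lange (2023), §1.1.1: period parallelotopes);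
* `ComplexTorus.weight Φ K x = Π_{k ∈ K} ψ(x_k)` — a smooth FUNDAMENTAL WEIGHT for `Λ_K`:
  `Σ_{λ ∈ Λ_K} weight(x + λ) = 1` (`sum_weight_eq_one`), hence `Σ_λ D weight(x + λ) = 0`
  (`sum_fderiv_weight_eq_zero`);
* `ComplexTorus.integral_eq_sum_setIntegral_slab` — UNFOLDING: for a `Λ_K`-invariant measure `μ`
  and a `μ`-integrable `f`, `∫ f dμ = Σ_λ ∫_{slab} f(λ + x) dμ` (Mathlib's
  `IsAddFundamentalDomain.integral_eq_tsum''`, the sum being finite for the supports at hand);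
* **`HolomorphicChain.setIntegral_slab_extDeriv_eq_zero`** — STOKES OVER THE SLAB: for a holomorphic
  `(q+1)`-chain `T` on `E` with `Λ`-periodic carrier and density, and a smooth real `(2q+1)`-form `Ψ`
  on `E` which is `Λ_K`-periodic and supported in a region bounded in the directions outside `K`,
  `∫_{slab} θ_T ⟨dΨ, ξ_T⟩ d𝓗^{2q+2} = 0`. Proof: `[T](d(w Ψ)) = 0` (Harvey) for the compactly supported
  form `w Ψ`, `w = weight`; by the Leibniz rule this is `∫ θ ⟨dw ∧ Ψ, ξ⟩ + ∫ w θ ⟨dΨ, ξ⟩`; unfolding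
  turns the second integral into `∫_{slab} θ ⟨dΨ, ξ⟩` (`Σ_λ w(· + λ) = 1`) and the first into
  `∫_{slab} θ ⟨(Σ_λ dw(· + λ)) ∧ Ψ, ξ⟩ = 0`.

This is the form of Stokes' theorem `∫_Z dβ = 0` (Voisin (2002), §11.1.2, Thm. 11.21: the current of
integration over a closed analytic subset is closed; Griffiths–Harris, Ch. 0 §4 and Ch. 3 §1) that the
integrality proof (push-forward of `[A]` over a slab to `ℝ^{2d}`, constancy theorem) consumes.

Definitions with bodies (`unitPartition`, `latticeVecOn`, `coordSubLattice`, `slab`, `weight`) and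
theorems; no named fact.

## References

* [VoisinHodgeI2002] C. Voisin, *Hodge Theory and Complex Algebraic Geometry I*, CUP (2002), §11.1.2
  Thm. 11.21 (closedness of the current of integration, after Lelong).
* [Harvey1977] R. Harvey, *Holomorphic chains and their boundaries*, PSPUM XXX.1 (1977), Thm. 1.8
  (`d[T] = 0`).
* [Lange2023AbelianVarietiesComplex] H. Lange, *Abelian Varieties over the Complex Numbers*, Springer
  (2023), §1.1.1, §1.1.4.
* [Federer1969] H. Federer, *Geometric Measure Theory*, Springer (1969), 4.1.7.
-/

noncomputable section

open scoped Manifold ENNReal NNReal Pointwise Topology ContDiff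
open MeasureTheory TopologicalSpace Set Function Module Metric Filter
open Literature.Geometry.GeometricMeasureTheory

namespace Literature.Geometry.Kaehler

-- Nested operator-norm instances on `Covector V m` / `Multivector V m`, as in `Currents.lean`.
set_option maxSynthPendingDepth 2

universe u

/-! ### The smooth unit partition of `ℝ` -/

/-- **The bump `ψ(t) = S(t) − S(t − 1)`** (`S` = `Real.smoothTransition`): smooth, `0 ≤ ψ ≤ 1`,
supported in `[0, 2]`, and `Σ_{m ∈ ℤ} ψ(t + m) = 1` (telescoping). [cite: Federer1969, 4.1.7] -/
def unitPartition (t : ℝ) : ℝ := Real.smoothTransition t - Real.smoothTransition (t - 1)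

/-- `ψ` is smooth. [cite: Federer1969, 4.1.7] -/
theorem contDiff_unitPartition {n : ℕ∞} : ContDiff ℝ n unitPartition :=
  Real.smoothTransition.contDiff.sub (Real.smoothTransition.contDiff.comp (contDiff_id.sub contDiff_const))

/-- `0 ≤ ψ`. [cite: Federer1969, 4.1.7] -/
theorem unitPartition_nonneg (t : ℝ) : 0 ≤ unitPartition t :=
  sub_nonneg.2 (Real.smoothTransition.monotone (by linarith))

/-- `ψ ≤ 1`. [cite: Federer1969, 4.1.7] -/
theorem unitPartition_le_one (t : ℝ) : unitPartition t ≤ 1 := by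
  have h1 := Real.smoothTransition.le_one t
  have h2 := Real.smoothTransition.nonneg (t - 1)
  unfold unitPartition; linarith

/-- `|ψ| ≤ 1`. [cite: Federer1969, 4.1.7] -/
theorem abs_unitPartition_le_one (t : ℝ) : |unitPartition t| ≤ 1 :=
  abs_le.2 ⟨by linarith [unitPartition_nonneg t], unitPartition_le_one t⟩

/-- `ψ(t) = 0` for `t ≤ 0`. [cite: Federer1969, 4.1.7] -/
theorem unitPartition_eq_zero_of_nonpos {t : ℝ} (ht : t ≤ 0) : unitPartition t = 0 := by
  rw [unitPartition, Real.smoothTransition.zero_of_nonpos ht,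
    Real.smoothTransition.zero_of_nonpos (by linarith), sub_zero]

/-- `ψ(t) = 0` for `t ≥ 2`. [cite: Federer1969, 4.1.7] -/
theorem unitPartition_eq_zero_of_two_le {t : ℝ} (ht : 2 ≤ t) : unitPartition t = 0 := by
  rw [unitPartition, Real.smoothTransition.one_of_one_le (by linarith),
    Real.smoothTransition.one_of_one_le (by linarith), sub_self]

/-- `ψ(t) ≠ 0` forces `0 < t < 2`. [cite: Federer1969, 4.1.7] -/
theorem mem_Ioo_of_unitPartition_ne_zero {t : ℝ} (ht : unitPartition t ≠ 0) : t ∈ Ioo (0 : ℝ) 2 := by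
  by_contra h
  rw [mem_Ioo, not_and_or, not_lt, not_lt] at h
  rcases h with h | h
  · exact ht (unitPartition_eq_zero_of_nonpos h)
  · exact ht (unitPartition_eq_zero_of_two_le h)

/-- **Telescoping: `ψ(t-1) + ψ(t) + ψ(t+1) + ψ(t+2) = 1` for `-1 < t < 2`** — all the non-zero terms
of `Σ_{m ∈ ℤ} ψ(t + m)`. [cite: Federer1969, 4.1.7] -/
theorem unitPartition_telescope {t : ℝ} (ht : t ∈ Ioo (-1 : ℝ) 2) :
    unitPartition (t + (-1 : ℤ)) + unitPartition (t + (0 : ℤ)) + unitPartition (t + (1 : ℤ)) +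
      unitPartition (t + (2 : ℤ)) = 1 := by
  have h1 : Real.smoothTransition (t + 2) = 1 := Real.smoothTransition.one_of_one_le (by linarith [ht.1])
  have h2 : Real.smoothTransition (t + (-1) - 1) = 0 :=
    Real.smoothTransition.zero_of_nonpos (by linarith [ht.2])
  simp only [unitPartition, Int.cast_neg, Int.cast_one, Int.cast_zero, Int.cast_ofNat, add_zero]
  rw [h1, h2]
  ring_nf

/-- The index window `{-1, 0, 1, 2} ⊆ ℤ`. [cite: Federer1969, 4.1.7] -/
def window : Finset ℤ := {-1, 0, 1, 2}

/-- `Σ_{m ∈ {-1,0,1,2}} ψ(t + m) = 1` for `-1 < t < 2`. [cite: Federer1969, 4.1.7] -/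
theorem sum_window_unitPartition {t : ℝ} (ht : t ∈ Ioo (-1 : ℝ) 2) :
    ∑ m ∈ window, unitPartition (t + m) = 1 := by
  rw [← unitPartition_telescope ht, window, Finset.sum_insert (by decide), Finset.sum_insert (by decide),
    Finset.sum_insert (by decide), Finset.sum_singleton]
  ring

/-- For `-1 < t < 2`, `ψ(t + m) ≠ 0` forces `m ∈ {-1, 0, 1, 2}`. [cite: Federer1969, 4.1.7] -/
theorem mem_window_of_unitPartition_ne_zero {t : ℝ} (ht : t ∈ Ioo (-1 : ℝ) 2) {m : ℤ}
    (hm : unitPartition (t + m) ≠ 0) : m ∈ window := by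
  have h := mem_Ioo_of_unitPartition_ne_zero hm
  have hm1 : (-2 : ℝ) < m := by linarith [h.1, ht.2]
  have hm2 : (m : ℝ) < 3 := by linarith [h.2, ht.1]
  have hm1' : -2 < m := by exact_mod_cast hm1
  have hm2' : m < 3 := by exact_mod_cast hm2
  rw [window]
  simp only [Finset.mem_insert, Finset.mem_singleton]
  omega

namespace ComplexTorus

/-! ### Sub-lattices spanned by coordinate directions and their slab fundamental domains -/

section CoordSubLattice

variable {ι : Type*} {E : Type u} [NormedAddCommGroup E] [NormedSpace ℂ E]
  (Φ : (ι → ℝ) ≃L[ℝ] E) (K : Finset ι)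

/-- **The slab** `{x | x_k ∈ [a_k, a_k + 1) for k ∈ K}` (coordinates `x = Φ⁻¹`): a fundamental domain
of the sub-lattice `Λ_K` (Lange (2023), §1.1.1: the period parallelotope, here only in the directions
of `K`). [cite: Lange2023AbelianVarietiesComplex, §1.1.1] -/
def slab (a : ι → ℝ) : Set E := {x | ∀ k ∈ K, Φ.symm x k ∈ Ico (a k) (a k + 1)}

/-- Membership in the slab. [cite: Lange2023AbelianVarietiesComplex, §1.1.1] -/
theorem mem_slab_iff {a : ι → ℝ} {x : E} : x ∈ slab Φ K a ↔ ∀ k ∈ K, Φ.symm x k ∈ Ico (a k) (a k + 1) :=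
  Iff.rfl

/-- Points of the slab `{x_k ∈ [0,1)}` satisfy `-1 < x_k < 2`. [cite: Lange2023AbelianVarietiesComplex, §1.1.1] -/
theorem mem_Ioo_of_mem_slab {x : E} (hx : x ∈ slab Φ K 0) {k : ι} (hk : k ∈ K) :
    Φ.symm x k ∈ Ioo (-1 : ℝ) 2 := by
  have h := hx k hk
  simp only [Pi.zero_apply, zero_add, mem_Ico] at h
  exact ⟨by linarith [h.1], by linarith [h.2]⟩

/-- The region `{-1 < x_k < 2, k ∈ K}` is open. [cite: Lange2023AbelianVarietiesComplex, §1.1.1] -/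
theorem isOpen_setOf_mem_Ioo : IsOpen {x : E | ∀ k ∈ K, Φ.symm x k ∈ Ioo (-1 : ℝ) 2} := by
  have h : {x : E | ∀ k ∈ K, Φ.symm x k ∈ Ioo (-1 : ℝ) 2} =
      ⋂ k ∈ K, (fun x ↦ Φ.symm x k) ⁻¹' Ioo (-1 : ℝ) 2 := by
    ext x; simp
  rw [h]
  exact isOpen_biInter_finset fun k _ ↦
    isOpen_Ioo.preimage ((continuous_apply k).comp Φ.symm.continuous)

/-- The slab is a Borel set. [cite: Lange2023AbelianVarietiesComplex, §1.1.1] -/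
theorem measurableSet_slab [MeasurableSpace E] [BorelSpace E] (a : ι → ℝ) :
    MeasurableSet (slab Φ K a) := by
  have h : slab Φ K a = ⋂ k ∈ K, (fun x ↦ Φ.symm x k) ⁻¹' Ico (a k) (a k + 1) := by
    ext x; simp [mem_slab_iff]
  rw [h]
  exact MeasurableSet.biInter (Set.to_countable _) fun k _ ↦
    measurableSet_Ico.preimage ((continuous_apply k).comp Φ.symm.continuous).measurable

variable [DecidableEq ι]

/-- Extension by zero of an integer vector on `K` to `ι`. [cite: Lange2023AbelianVarietiesComplex, §1.1.1] -/
def extendOn (m : K → ℤ) : ι → ℤ := fun i ↦ if h : i ∈ K then m ⟨i, h⟩ else 0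

/-- `extendOn` on `K`. [cite: Lange2023AbelianVarietiesComplex, §1.1.1] -/
@[simp] theorem extendOn_apply_of_mem (m : K → ℤ) {i : ι} (hi : i ∈ K) :
    extendOn K m i = m ⟨i, hi⟩ := by
  rw [extendOn, dif_pos hi]

/-- `extendOn` off `K`. [cite: Lange2023AbelianVarietiesComplex, §1.1.1] -/
@[simp] theorem extendOn_apply_of_notMem (m : K → ℤ) {i : ι} (hi : i ∉ K) : extendOn K m i = 0 := by
  rw [extendOn, dif_neg hi]

/-- **The lattice vectors supported in `K`**: `m ↦ Φ(m on K, 0 off K)`, as a group homomorphism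
`ℤ^K →+ E`. [cite: Lange2023AbelianVarietiesComplex, §1.1.1] -/
def latticeVecOn : (K → ℤ) →+ E where
  toFun m := latticeVec Φ (extendOn K m)
  map_zero' := by
    have h : extendOn K (0 : K → ℤ) = 0 := by
      funext i; by_cases hi : i ∈ K <;> simp [hi]
    rw [h, ← latticeVecHom_apply, map_zero]
  map_add' m m' := by
    have h : extendOn K (m + m') = extendOn K m + extendOn K m' := by
      funext i; by_cases hi : i ∈ K <;> simp [hi]
    rw [h, ← latticeVecHom_apply, map_add, latticeVecHom_apply, latticeVecHom_apply]

/-- Unfolding `latticeVecOn`. [cite: Lange2023AbelianVarietiesComplex, §1.1.1] -/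
theorem latticeVecOn_apply (m : K → ℤ) : latticeVecOn Φ K m = latticeVec Φ (extendOn K m) := rfl

/-- Coordinates of `latticeVecOn Φ K m` in `K`. [cite: Lange2023AbelianVarietiesComplex, §1.1.1] -/
theorem symm_latticeVecOn_apply_of_mem (m : K → ℤ) {i : ι} (hi : i ∈ K) :
    Φ.symm (latticeVecOn Φ K m) i = (m ⟨i, hi⟩ : ℝ) := by
  rw [latticeVecOn_apply, symm_latticeVec_apply, extendOn_apply_of_mem K m hi]

/-- Coordinates of `latticeVecOn Φ K m` off `K` vanish. [cite: Lange2023AbelianVarietiesComplex, §1.1.1] -/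
theorem symm_latticeVecOn_apply_of_notMem (m : K → ℤ) {i : ι} (hi : i ∉ K) :
    Φ.symm (latticeVecOn Φ K m) i = 0 := by
  rw [latticeVecOn_apply, symm_latticeVec_apply, extendOn_apply_of_notMem K m hi, Int.cast_zero]

/-- `latticeVecOn` is injective. [cite: Lange2023AbelianVarietiesComplex, §1.1.1] -/
theorem latticeVecOn_injective : Function.Injective (latticeVecOn Φ K) := by
  intro m m' h
  funext ⟨i, hi⟩
  have h1 := congrArg (fun x ↦ Φ.symm x i) h
  simp only [symm_latticeVecOn_apply_of_mem Φ K _ hi, Int.cast_inj] at h1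
  exact h1

/-- **The sub-lattice `Λ_K = Φ(ℤ^K × 0) ≤ Λ`** of lattice vectors supported in the coordinate set `K`.
[cite: Lange2023AbelianVarietiesComplex, §1.1.1] -/
def coordSubLattice : AddSubgroup E := (latticeVecOn Φ K).range

/-- Membership in `Λ_K`. [cite: Lange2023AbelianVarietiesComplex, §1.1.1] -/
theorem mem_coordSubLattice_iff {x : E} : x ∈ coordSubLattice Φ K ↔ ∃ m : K → ℤ, latticeVecOn Φ K m = x :=
  AddMonoidHom.mem_range

/-- `Λ_K ≤ Λ`. [cite: Lange2023AbelianVarietiesComplex, §1.1.1] -/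
theorem coordSubLattice_le_periodLattice : coordSubLattice Φ K ≤ periodLattice Φ := by
  rintro x ⟨m, rfl⟩
  exact latticeVec_mem_periodLattice Φ _

/-- `Λ_K` is countable. [folklore] -/
instance countable_coordSubLattice : Countable (coordSubLattice Φ K) := by
  have h : (coordSubLattice Φ K : Set E).Countable := by
    rw [coordSubLattice, AddMonoidHom.coe_range]; exact Set.countable_range _
  exact h.to_subtype

/-- `Λ_K` acts on `E` by isometries. [folklore] -/
instance isIsometricVAdd_coordSubLattice : IsIsometricVAdd (coordSubLattice Φ K) E :=
  ⟨fun g ↦ (isometry_vadd E (g : E) : _)⟩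

/-- The action: `g +ᵥ x = g + x`. [cite: Lange2023AbelianVarietiesComplex, §1.1.1] -/
theorem coordSubLattice_vadd (g : coordSubLattice Φ K) (x : E) : g +ᵥ x = (g : E) + x := rfl

/-- The equivalence `ℤ^K ≃ Λ_K`. [cite: Lange2023AbelianVarietiesComplex, §1.1.1] -/
def coordSubLatticeEquiv : (K → ℤ) ≃ coordSubLattice Φ K :=
  Equiv.ofBijective (fun m ↦ ⟨latticeVecOn Φ K m, m, rfl⟩)
    ⟨fun m m' h ↦ latticeVecOn_injective Φ K (congrArg Subtype.val h),
      fun ⟨x, hx⟩ ↦ by obtain ⟨m, rfl⟩ := hx; exact ⟨m, rfl⟩⟩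

/-- Unfolding `coordSubLatticeEquiv`. [cite: Lange2023AbelianVarietiesComplex, §1.1.1] -/
@[simp] theorem coe_coordSubLatticeEquiv (m : K → ℤ) : ((coordSubLatticeEquiv Φ K m : coordSubLattice Φ K) : E) =
    latticeVecOn Φ K m := rfl

/-- **The slab is a fundamental domain of `Λ_K`, for every measure**: every point has exactly one
`Λ_K`-translate in it (Euclidean division of the coordinates in `K`).
[cite: Lange2023AbelianVarietiesComplex, §1.1.1] -/
theorem isAddFundamentalDomain_slab [MeasurableSpace E] [BorelSpace E] (a : ι → ℝ) (μ : Measure E) :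
    IsAddFundamentalDomain (coordSubLattice Φ K) (slab Φ K a) μ := by
  refine IsAddFundamentalDomain.mk' (measurableSet_slab Φ K a).nullMeasurableSet fun x ↦ ?_
  set y : ι → ℝ := Φ.symm x with hy
  set m₀ : K → ℤ := fun k ↦ -toIcoDiv zero_lt_one (a k) (y k) with hm₀
  have hcoord : ∀ (m : K → ℤ) (k : ι) (hk : k ∈ K),
      Φ.symm (latticeVecOn Φ K m + x) k = y k - (-m ⟨k, hk⟩) • (1 : ℝ) := fun m k hk ↦ by
    rw [map_add, Pi.add_apply, symm_latticeVecOn_apply_of_mem Φ K m hk]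
    simp [hy]; ring
  have key : ∀ m : K → ℤ, latticeVecOn Φ K m + x ∈ slab Φ K a ↔ m = m₀ := by
    intro m
    rw [mem_slab_iff]
    constructor
    · intro h
      funext ⟨k, hk⟩
      have hk' := h k hk
      rw [hcoord m k hk, show a k + 1 = a k + (1 : ℝ) from rfl] at hk'
      have := toIcoDiv_eq_of_sub_zsmul_mem_Ico (hp := zero_lt_one) hk'
      simp [hm₀, this]
    · rintro rfl k hk
      rw [hcoord m₀ k hk]
      have h := sub_toIcoDiv_zsmul_mem_Ico zero_lt_one (a k) (y k)
      simpa [hm₀] using h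
  refine ⟨coordSubLatticeEquiv Φ K m₀, (key m₀).2 rfl, ?_⟩
  intro g hg
  obtain ⟨m, rfl⟩ := (coordSubLatticeEquiv Φ K).surjective g
  have hm : m = m₀ := (key m).1 hg
  rw [hm]

end CoordSubLattice

/-! ### The fundamental weight of a coordinate sub-lattice -/

section Weight

variable {ι : Type*} {E : Type u} [NormedAddCommGroup E] [NormedSpace ℂ E]
  (Φ : (ι → ℝ) ≃L[ℝ] E) (K : Finset ι)

/-- **The fundamental weight `w_K(x) = Π_{k ∈ K} ψ(x_k)`** of the sub-lattice `Λ_K`: smooth,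
`0 ≤ w_K ≤ 1`, supported where `x_k ∈ [0, 2]` for `k ∈ K`, with `Σ_{λ ∈ Λ_K} w_K(x + λ) = 1`.
[cite: Federer1969, 4.1.7] -/
def weight (x : E) : ℝ := ∏ k ∈ K, unitPartition (Φ.symm x k)

/-- `w_K` is smooth. [cite: Federer1969, 4.1.7] -/
theorem contDiff_weight {n : ℕ∞} : ContDiff ℝ n (weight Φ K) :=
  contDiff_prod fun k _ ↦ contDiff_unitPartition.comp
    (((ContinuousLinearMap.proj k).comp (Φ.symm : E →L[ℝ] (ι → ℝ))).contDiff)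

/-- `|w_K| ≤ 1`. [cite: Federer1969, 4.1.7] -/
theorem abs_weight_le_one (x : E) : |weight Φ K x| ≤ 1 := by
  rw [weight, Finset.abs_prod]
  exact Finset.prod_le_one (fun _ _ ↦ abs_nonneg _) fun k _ ↦ abs_unitPartition_le_one _

/-- `w_K(x) ≠ 0` forces `0 < x_k < 2` for `k ∈ K`. [cite: Federer1969, 4.1.7] -/
theorem mem_Ioo_of_weight_ne_zero {x : E} (hx : weight Φ K x ≠ 0) {k : ι} (hk : k ∈ K) :
    Φ.symm x k ∈ Ioo (0 : ℝ) 2 :=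
  mem_Ioo_of_unitPartition_ne_zero fun h ↦ hx (Finset.prod_eq_zero hk h)

variable [DecidableEq ι]

/-- The weight at a `Λ_K`-translate: `w_K(Φm + x) = Π_k ψ(x_k + m_k)`. [cite: Federer1969, 4.1.7] -/
theorem weight_latticeVecOn_add (m : K → ℤ) (x : E) :
    weight Φ K (latticeVecOn Φ K m + x) = ∏ k : K, unitPartition (Φ.symm x k + m k) := by
  rw [weight, ← Finset.prod_coe_sort K]
  refine Finset.prod_congr rfl fun k _ ↦ ?_
  rw [map_add, Pi.add_apply, symm_latticeVecOn_apply_of_mem Φ K m k.2, add_comm]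

/-- The window `{-1,0,1,2}^K` of relevant translates. [cite: Federer1969, 4.1.7] -/
def windowOn : Finset (K → ℤ) := Fintype.piFinset fun _ ↦ window

/-- **`Σ_{m ∈ {-1,0,1,2}^K} w_K(Φm + x) = 1` whenever `-1 < x_k < 2` for all `k ∈ K`** (the product of
the one-dimensional telescoping sums). [cite: Federer1969, 4.1.7] -/
theorem sum_windowOn_weight {x : E} (hx : ∀ k ∈ K, Φ.symm x k ∈ Ioo (-1 : ℝ) 2) :
    ∑ m ∈ windowOn K, weight Φ K (latticeVecOn Φ K m + x) = 1 := by
  simp_rw [weight_latticeVecOn_add]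
  rw [windowOn, ← Finset.prod_univ_sum (fun _ : K ↦ window) (fun k (j : ℤ) ↦ unitPartition (Φ.symm x k + j))]
  exact Finset.prod_eq_one fun k _ ↦ sum_window_unitPartition (hx k k.2)

/-- Off the window the translated weight vanishes: if `-1 < x_k < 2` for `k ∈ K` and
`w_K(Φm + x) ≠ 0` then `m ∈ {-1,0,1,2}^K`. [cite: Federer1969, 4.1.7] -/
theorem mem_windowOn_of_weight_ne_zero {x : E} (hx : ∀ k ∈ K, Φ.symm x k ∈ Ioo (-1 : ℝ) 2)
    {m : K → ℤ} (hm : weight Φ K (latticeVecOn Φ K m + x) ≠ 0) : m ∈ windowOn K := by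
  rw [windowOn, Fintype.mem_piFinset]
  intro k
  rw [weight_latticeVecOn_add] at hm
  exact mem_window_of_unitPartition_ne_zero (hx k k.2)
    fun h ↦ hm (Finset.prod_eq_zero (Finset.mem_univ k) h)

/-- **`Σ_{m ∈ window} D w_K(Φm + x) = 0` on the slab**: the finite sum `Σ_m w_K(Φm + ·)` is the
constant `1` on the open region `{-1 < x_k < 2}` containing the slab. [cite: Federer1969, 4.1.7] -/
theorem sum_windowOn_fderiv_weight_eq_zero {x : E} (hx : x ∈ slab Φ K 0) :
    ∑ m ∈ windowOn K, fderiv ℝ (weight Φ K) (latticeVecOn Φ K m + x) = 0 := by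
  have hx' : ∀ k ∈ K, Φ.symm x k ∈ Ioo (-1 : ℝ) 2 := fun k hk ↦ mem_Ioo_of_mem_slab Φ K hx hk
  -- the sum function is eventually the constant `1` near `x`
  have hev : (fun y ↦ ∑ m ∈ windowOn K, weight Φ K (latticeVecOn Φ K m + y)) =ᶠ[𝓝 x] fun _ ↦ (1 : ℝ) :=
    Filter.eventually_of_mem ((isOpen_setOf_mem_Ioo Φ K).mem_nhds hx')
      fun y hy ↦ sum_windowOn_weight Φ K hy
  have h0 : fderiv ℝ (fun y ↦ ∑ m ∈ windowOn K, weight Φ K (latticeVecOn Φ K m + y)) x = 0 := by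
    rw [hev.fderiv_eq, fderiv_const_apply]
  have hdiff : ∀ m ∈ windowOn K, DifferentiableAt ℝ (fun y ↦ weight Φ K (latticeVecOn Φ K m + y)) x :=
    fun m _ ↦ ((contDiff_weight Φ K (n := 1)).differentiable one_ne_zero).differentiableAt.comp x
      ((differentiableAt_const _).add differentiableAt_id)
  rw [fderiv_fun_sum hdiff] at h0
  rw [← h0]
  refine Finset.sum_congr rfl fun m _ ↦ ?_
  rw [fderiv_comp_add_left]

end Weight

/-! ### Unfolding an integral over the slab -/

section Unfold

variable {ι : Type*} [DecidableEq ι] {E : Type u} [NormedAddCommGroup E] [NormedSpace ℂ E]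
  [MeasurableSpace E] [BorelSpace E] (Φ : (ι → ℝ) ≃L[ℝ] E) (K : Finset ι)
  {F : Type*} [NormedAddCommGroup F] [NormedSpace ℝ F]

/-- A lattice integer `m` with `-2 < m < 3` lies in the window. [cite: Federer1969, 4.1.7] -/
theorem mem_window_of_lt_of_lt {m : ℤ} (h1 : -2 < m) (h2 : m < 3) : m ∈ window := by
  rw [window]
  simp only [Finset.mem_insert, Finset.mem_singleton]
  omega

/-- **Unfolding over the slab.** For a `Λ_K`-invariant measure `μ` and a `μ`-integrable `f` whose
translates `f(Φm + ·)`, `m ∈ ℤ^K`, vanish on the slab unless `m` lies in a finite set `G`: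
`∫ f dμ = Σ_{m ∈ G} ∫_{slab} f(Φm + x) dμ(x)` (Mathlib's `IsAddFundamentalDomain.integral_eq_tsum''`
for the fundamental domain `slab`). [cite: Lange2023AbelianVarietiesComplex, §1.1.1] -/
theorem integral_eq_sum_setIntegral_slab {μ : Measure E} [VAddInvariantMeasure (coordSubLattice Φ K) E μ]
    {f : E → F} (hf : Integrable f μ) (G : Finset (K → ℤ))
    (hG : ∀ (m : K → ℤ), ∀ x ∈ slab Φ K 0, f (latticeVecOn Φ K m + x) ≠ 0 → m ∈ G) :
    ∫ x, f x ∂μ = ∑ m ∈ G, ∫ x in slab Φ K 0, f (latticeVecOn Φ K m + x) ∂μ := by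
  rw [(isAddFundamentalDomain_slab Φ K 0 μ).integral_eq_tsum'' f hf,
    ← (coordSubLatticeEquiv Φ K).tsum_eq]
  simp only [coordSubLattice_vadd, coe_coordSubLatticeEquiv]
  refine tsum_eq_sum fun m hm ↦ setIntegral_eq_zero_of_forall_eq_zero fun x hx ↦ ?_
  by_contra h
  exact hm (hG m x hx h)

end Unfold

end ComplexTorus

/-! ### Stokes' theorem for a periodic chain over the slab -/

/-! ### Calculus lemmas -/

section Aux

variable {V : Type u} [NormedAddCommGroup V] [NormedSpace ℝ V]

/-- A `G`-invariant measure restricted to a measurable `G`-invariant set is `G`-invariant. [folklore] -/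
private theorem vaddInvariantMeasure_restrict {G α : Type*} [AddGroup G] [AddAction G α]
    [MeasurableSpace α] [MeasurableConstVAdd G α] {μ : Measure α} [VAddInvariantMeasure G α μ]
    {s : Set α} (hs : MeasurableSet s) (hinv : ∀ g : G, (fun x ↦ g +ᵥ x) ⁻¹' s = s) :
    VAddInvariantMeasure G α (μ.restrict s) := by
  refine ⟨fun g t ht ↦ ?_⟩
  have hgt : MeasurableSet ((fun x ↦ g +ᵥ x) ⁻¹' t) := measurable_const_vadd g ht
  rw [Measure.restrict_apply hgt, Measure.restrict_apply ht]
  conv_lhs => rw [← hinv g, ← preimage_inter]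
  exact VAddInvariantMeasure.measure_preimage_vadd g (ht.inter hs)

/-- **Leibniz rule, pointwise**: `d(g Ψ)(x) = dg(x) ∧ Ψ(x) + g(x) dΨ(x)` for a smooth function `g`
and a smooth form `Ψ` (Mathlib's normalisation of `d`; `dg ∧ η = alternatizeUncurryFin (dg ⊗ η)`).
[cite: Federer1969, 4.1.6] -/
theorem extDeriv_smul_apply_eq {k : ℕ} {g : V → ℝ} (hg : ContDiff ℝ ∞ g)
    {Ψ : V → V [⋀^Fin k]→L[ℝ] ℝ} (hΨ : ContDiff ℝ ∞ Ψ) (x : V) :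
    extDeriv (fun y ↦ g y • Ψ y) x =
      ContinuousAlternatingMap.alternatizeUncurryFin ((fderiv ℝ g x).smulRight (Ψ x)) +
        g x • extDeriv Ψ x := by
  rw [extDeriv, extDeriv, fderiv_fun_smul (hg.differentiable (by simp) x) (hΨ.differentiable (by simp) x),
    ContinuousAlternatingMap.alternatizeUncurryFin_add,
    add_comm (ContinuousAlternatingMap.alternatizeUncurryFin (g x • fderiv ℝ Ψ x))]
  congr 1
  exact (ContinuousAlternatingMap.alternatizeUncurryFinCLM ℝ V ℝ).map_smul (g x) (fderiv ℝ Ψ x)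

/-- `d` commutes with translations: `d(Ψ(b + ·))(x) = dΨ(b + x)`. [folklore] -/
private theorem extDeriv_comp_add_left {k : ℕ} (Ψ : V → V [⋀^Fin k]→L[ℝ] ℝ) (b x : V) :
    extDeriv (fun y ↦ Ψ (b + y)) x = extDeriv Ψ (b + x) := by
  rw [extDeriv, extDeriv, fderiv_comp_add_left]

/-- A form which vanishes near `x` has `dΨ(x) = 0`. [folklore] -/
private theorem extDeriv_eq_zero_of_notMem_tsupport {k : ℕ} {Ψ : V → V [⋀^Fin k]→L[ℝ] ℝ} {x : V}
    (hx : x ∉ tsupport Ψ) : extDeriv Ψ x = 0 := by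
  have h : Ψ =ᶠ[𝓝 x] fun _ ↦ 0 := notMem_tsupport_iff_eventuallyEq.1 hx
  rw [h.extDeriv_eq, extDeriv, fderiv_const_apply]
  exact (ContinuousAlternatingMap.alternatizeUncurryFinCLM ℝ V ℝ).map_zero

/-- A function which vanishes near `x` has `Dg(x) = 0`. [folklore] -/
private theorem fderiv_eq_zero_of_notMem_tsupport {g : V → ℝ} {x : V} (hx : x ∉ tsupport g) :
    fderiv ℝ g x = 0 := by
  have h : g =ᶠ[𝓝 x] fun _ ↦ 0 := notMem_tsupport_iff_eventuallyEq.1 hx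
  rw [h.fderiv_eq, fderiv_const_apply]

end Aux

namespace HolomorphicChain

section Stokes

variable {ι : Type*} [DecidableEq ι] {E : Type u} [NormedAddCommGroup E]
  [InnerProductSpace ℂ E] [FiniteDimensional ℂ E] [MeasurableSpace E] [BorelSpace E]
  (Φ : (ι → ℝ) ≃L[ℝ] E) (K : Finset ι) {q : ℕ}

/-- `𝓗^{2q+2} ⌞ reg|T|` is `Λ_K`-invariant when the carrier is `Λ`-periodic.
[cite: Lange2023AbelianVarietiesComplex, §1.1.4] -/
theorem vaddInvariantMeasure_coordSubLattice (T : HolomorphicChain 𝓘(ℂ, E) (⊤ : Opens E) (q + 1))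
    (hcar : ∀ (m : ι → ℤ) (x : E), ComplexTorus.latticeVec Φ m + x ∈ T.carrier ↔ x ∈ T.carrier) :
    VAddInvariantMeasure (ComplexTorus.coordSubLattice Φ K) E
      ((μHE[2 * (q + 1)] : Measure E).restrict T.carrier) := by
  letI : InnerProductSpace ℝ E := InnerProductSpace.complexToReal
  refine vaddInvariantMeasure_restrict T.isRectifiableData.1 fun g ↦ ?_
  obtain ⟨m, hm⟩ := (ComplexTorus.mem_coordSubLattice_iff Φ K).1 g.2
  ext x
  rw [mem_preimage, ComplexTorus.coordSubLattice_vadd, ← hm, ComplexTorus.latticeVecOn_apply]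
  exact hcar _ x

/-- **Integrability of the pairing of the density of a chain with a continuous form on a compact
set** (Lelong: the vector density `θ_T ξ⃗_T` is integrable on compact sets).
[cite: Harvey1977, Lemma 1.3] -/
theorem integrableOn_density_mul_apply_of_isCompact (T : HolomorphicChain 𝓘(ℂ, E) (⊤ : Opens E) (q + 1))
    {S : Set E} (hS : IsCompact S) {η : E → E [⋀^Fin (2 * (q + 1))]→L[ℝ] ℝ} (hη : Continuous η) :
    IntegrableOn (fun x ↦ (T.density x : ℝ) * η x (T.orientationFrame x)) S
      ((μHE[2 * (q + 1)] : Measure E).restrict T.carrier) := by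
  set μ := (μHE[2 * (q + 1)] : Measure E).restrict T.carrier with hμ
  have hG : IntegrableOn (fun x ↦ (T.density x : ℝ) • frameVector (T.orientationFrame x)) S μ :=
    T.integrableOn_density_smul_frameVector_of_subset_isCompact Subset.rfl hS (fun _ _ ↦ trivial)
  -- `x ↦ (θ ξ⃗)(x) (η x)` is the composition of the continuous evaluation with measurable data
  have hmeas : AEStronglyMeasurable
      (fun x ↦ ((T.density x : ℝ) • frameVector (T.orientationFrame x)) (η x)) (μ.restrict S) := by
    have hc : Continuous fun p : Multivector E (2 * (q + 1)) × (E [⋀^Fin (2 * (q + 1))]→L[ℝ] ℝ) ↦ p.1 p.2 :=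
      isBoundedBilinearMap_apply.continuous
    exact hc.comp_aestronglyMeasurable (hG.aestronglyMeasurable.prodMk hη.aestronglyMeasurable)
  obtain ⟨M, hM⟩ := hS.exists_bound_of_continuousOn hη.continuousOn
  have hbound : ∀ᵐ x ∂(μ.restrict S),
      ‖((T.density x : ℝ) • frameVector (T.orientationFrame x)) (η x)‖ ≤
        ‖(T.density x : ℝ) • frameVector (T.orientationFrame x)‖ * M := by
    filter_upwards [ae_restrict_mem hS.isClosed.measurableSet] with x hx
    exact (ContinuousLinearMap.le_opNorm _ _).trans (mul_le_mul_of_nonneg_left (hM x hx) (norm_nonneg _))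
  have h := Integrable.mono' (hG.norm.mul_const M) hmeas hbound
  refine h.congr (ae_of_all _ fun x ↦ ?_)
  simp only [FunLike.coe_smul, Pi.smul_apply, frameVector_apply, smul_eq_mul]

/-- The coordinate box `{x | x_k ∈ [-1, 3] (k ∈ K), |x_i| ≤ R (i ∉ K)}`. [cite: Lange2023AbelianVarietiesComplex, §1.1.1] -/
def coordBox (R : ℝ) : Set E :=
  {x | (∀ k ∈ K, Φ.symm x k ∈ Icc (-1 : ℝ) 3) ∧ ∀ i, i ∉ K → |Φ.symm x i| ≤ R}

omit [DecidableEq ι] [FiniteDimensional ℂ E] [MeasurableSpace E] [BorelSpace E] in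
/-- The coordinate box is compact (the image under `Φ` of a product of compact intervals).
[cite: Lange2023AbelianVarietiesComplex, §1.1.1] -/
theorem isCompact_coordBox (R : ℝ) : IsCompact (coordBox Φ K R) := by
  classical
  have h : coordBox Φ K R =
      Φ '' Set.pi univ (fun i ↦ if i ∈ K then Icc (-1 : ℝ) 3 else Icc (-R) R) := by
    rw [ContinuousLinearEquiv.image_eq_preimage_symm]
    ext x
    simp only [coordBox, mem_setOf_eq, mem_preimage, mem_univ_pi]
    constructor
    · rintro ⟨h1, h2⟩ i
      by_cases hi : i ∈ K
      · rw [if_pos hi]; exact h1 i hi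
      · rw [if_neg hi]; exact abs_le.1 (h2 i hi)
    · intro h
      refine ⟨fun k hk ↦ ?_, fun i hi ↦ ?_⟩
      · have := h k; rwa [if_pos hk] at this
      · have := h i; rw [if_neg hi] at this; exact abs_le.2 this
  rw [h]
  exact (isCompact_univ_pi fun i ↦ by split_ifs <;> exact isCompact_Icc).image Φ.continuous

/-- **STOKES' THEOREM OVER THE SLAB for a periodic holomorphic chain.** Let `T` be a holomorphic
`(q+1)`-chain on `E` with `Λ`-periodic carrier `reg|T|` and density periodic on it (the lift
`π^* Z` of a cycle of the torus `E/Λ`), `K` a set of coordinate directions, and `Ψ` a smooth real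
`(2q+1)`-form on `E` which is `Λ_K`-periodic and vanishes where some coordinate `x_i`, `i ∉ K`, has
`|x_i| > R`. Then `∫_{slab} θ_T ⟨dΨ, ξ_T⟩ d𝓗^{2q+2} = 0` over the slab fundamental domain
`{x_k ∈ [0,1), k ∈ K}` of `Λ_K` — the periodic counterpart of the closedness `d[T] = 0` of the
current of integration (Voisin (2002), Thm. 11.21; Harvey (1977)). Proof: `[T](d(w Ψ)) = 0` for the
compactly supported form `w Ψ`, `w = weight Φ K`; Leibniz; unfolding over the slab with
`Σ_λ w(· + λ) = 1` and `Σ_λ Dw(· + λ) = 0`. [cite: VoisinHodgeI2002, §11.1.2 Thm. 11.21] -/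
theorem setIntegral_slab_density_mul_extDeriv_apply_eq_zero
    (T : HolomorphicChain 𝓘(ℂ, E) (⊤ : Opens E) (q + 1))
    (hcar : ∀ (m : ι → ℤ) (x : E), ComplexTorus.latticeVec Φ m + x ∈ T.carrier ↔ x ∈ T.carrier)
    (hdens : ∀ (m : ι → ℤ), ∀ x ∈ T.carrier,
      T.density (ComplexTorus.latticeVec Φ m + x) = T.density x)
    {Ψ : E → E [⋀^Fin (2 * q + 1)]→L[ℝ] ℝ} (hΨ : ContDiff ℝ ∞ Ψ)
    (hper : ∀ (m : K → ℤ) (x : E), Ψ (ComplexTorus.latticeVecOn Φ K m + x) = Ψ x)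
    {R : ℝ} (hR : ∀ x, Ψ x ≠ 0 → ∀ i, i ∉ K → |Φ.symm x i| ≤ R) :
    ∫ x in ComplexTorus.slab Φ K 0, (T.density x : ℝ) * extDeriv Ψ x (T.orientationFrame x)
      ∂((μHE[2 * (q + 1)] : Measure E).restrict T.carrier) = 0 := by
  letI : InnerProductSpace ℝ E := InnerProductSpace.complexToReal
  -- ### notation
  set μ : Measure E := (μHE[2 * (q + 1)] : Measure E).restrict T.carrier with hμ
  set w : E → ℝ := ComplexTorus.weight Φ K with hw
  set D : Set E := ComplexTorus.slab Φ K 0 with hD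
  set Q : Set E := coordBox Φ K R with hQ
  have hwC : ContDiff ℝ ∞ w := ComplexTorus.contDiff_weight Φ K
  have hQc : IsCompact Q := isCompact_coordBox Φ K R
  have hDm : MeasurableSet D := ComplexTorus.measurableSet_slab Φ K 0
  have hcarm : MeasurableSet T.carrier := T.isRectifiableData.1
  haveI : VAddInvariantMeasure (ComplexTorus.coordSubLattice Φ K) E μ :=
    T.vaddInvariantMeasure_coordSubLattice Φ K hcar
  -- the vector `Φm`, `m ∈ ℤ^K`, as a full lattice vector
  have hvec : ∀ m : K → ℤ, ComplexTorus.latticeVecOn Φ K m =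
      ComplexTorus.latticeVec Φ (ComplexTorus.extendOn K m) := fun m ↦ rfl
  -- ### supports
  have hΨ0 : ∀ x, (∃ i, i ∉ K ∧ R < |Φ.symm x i|) → Ψ x = 0 := by
    intro x ⟨i, hi, hlt⟩
    by_contra h
    exact (not_le.2 hlt) (hR x h i hi)
  have htsΨ : tsupport Ψ ⊆ {x | ∀ i, i ∉ K → |Φ.symm x i| ≤ R} := by
    refine closure_minimal (fun x hx i hi ↦ hR x hx i hi) ?_
    have h : {x : E | ∀ i, i ∉ K → |Φ.symm x i| ≤ R} = ⋂ (i : ι) (_ : i ∉ K),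
        (fun x ↦ |Φ.symm x i|) ⁻¹' Iic R := by ext x; simp
    rw [h]
    exact isClosed_biInter fun i _ ↦ isClosed_Iic.preimage
      (continuous_abs.comp ((continuous_apply i).comp Φ.symm.continuous))
  have hdΨ0 : ∀ x, (∃ i, i ∉ K ∧ R < |Φ.symm x i|) → extDeriv Ψ x = 0 := by
    intro x ⟨i, hi, hlt⟩
    exact extDeriv_eq_zero_of_notMem_tsupport fun h ↦ (not_le.2 hlt) (htsΨ h i hi)
  have hw0 : ∀ x, (∃ k ∈ K, Φ.symm x k ∉ Ioo (0 : ℝ) 2) → w x = 0 := by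
    intro x ⟨k, hk, hxk⟩
    by_contra h
    exact hxk (ComplexTorus.mem_Ioo_of_weight_ne_zero Φ K h hk)
  have htsw : tsupport w ⊆ {x | ∀ k ∈ K, Φ.symm x k ∈ Icc (0 : ℝ) 2} := by
    refine closure_minimal (fun x hx k hk ↦ ?_) ?_
    · exact Ioo_subset_Icc_self (ComplexTorus.mem_Ioo_of_weight_ne_zero Φ K hx hk)
    · have h : {x : E | ∀ k ∈ K, Φ.symm x k ∈ Icc (0 : ℝ) 2} = ⋂ k ∈ K,
          (fun x ↦ Φ.symm x k) ⁻¹' Icc (0 : ℝ) 2 := by ext x; simp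
      rw [h]
      exact isClosed_biInter fun k _ ↦ isClosed_Icc.preimage ((continuous_apply k).comp Φ.symm.continuous)
  have hDw0 : ∀ x, (∃ k ∈ K, Φ.symm x k ∉ Icc (0 : ℝ) 2) → fderiv ℝ w x = 0 := by
    intro x ⟨k, hk, hxk⟩
    exact fderiv_eq_zero_of_notMem_tsupport fun h ↦ hxk (htsw h k hk)
  -- off the box `Q`: either a `K`-coordinate leaves `[-1,3]` or another leaves `[-R, R]`
  have hQ_cases : ∀ x, x ∉ Q → (∃ k ∈ K, Φ.symm x k ∉ Icc (-1 : ℝ) 3) ∨ ∃ i, i ∉ K ∧ R < |Φ.symm x i| := by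
    intro x hx
    simp only [hQ, coordBox, mem_setOf_eq, not_and_or, not_forall, not_le, exists_prop] at hx
    rcases hx with ⟨k, hk, hxk⟩ | ⟨i, hi, hxi⟩
    · exact Or.inl ⟨k, hk, hxk⟩
    · exact Or.inr ⟨i, hi, hxi⟩
  -- ### the compactly supported form `w Ψ` and Harvey's `d[T] = 0`
  have hΘs : ContDiff ℝ ∞ fun x ↦ w x • Ψ x := hwC.smul hΨ
  have hΘc : HasCompactSupport fun x ↦ w x • Ψ x := by
    refine HasCompactSupport.intro hQc fun x hx ↦ ?_
    rcases hQ_cases x hx with ⟨k, hk, hxk⟩ | h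
    · rw [hw0 x ⟨k, hk, fun h ↦ hxk ⟨by linarith [h.1], by linarith [h.2]⟩⟩, zero_smul]
    · rw [hΨ0 x h, smul_zero]
  set Θ : TestForm (⊤ : Opens E) (2 * q + 1) := ⟨fun x ↦ w x • Ψ x, hΘs, hΘc, by simp⟩ with hΘ
  have hΘapply : ∀ x, Θ x = w x • Ψ x := fun _ ↦ rfl
  have h0 : ∫ y in T.carrier, (T.density y : ℝ) * (extDeriv ⇑Θ y) (T.orientationFrame y)
      ∂(μHE[2 * (q + 1)] : Measure E) = 0 := by
    have h := T.boundary_apply_eq_setIntegral Θ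
    rw [Harvey1977_boundary_toCurrent_eq_zero_holds E ⊤ q T] at h
    exact h.symm
  -- Leibniz: the integrand splits as `f₁ + f₂`
  set f₁ : E → ℝ := fun y ↦ (T.density y : ℝ) *
    (wedgeOne E (2 * q + 1) (fderiv ℝ w y) (Ψ y)) (T.orientationFrame y) with hf₁
  set F : E → ℝ := fun y ↦ (T.density y : ℝ) * extDeriv Ψ y (T.orientationFrame y) with hF
  set f₂ : E → ℝ := fun y ↦ w y * F y with hf₂
  have hsplit : ∀ y, (T.density y : ℝ) * (extDeriv ⇑Θ y) (T.orientationFrame y) = f₁ y + f₂ y := by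
    intro y
    have h := extDeriv_smul_apply_eq hwC hΨ y
    change extDeriv ⇑Θ y = _ at h
    rw [h]
    simp only [hf₁, hf₂, hF, wedgeOne_apply, ContinuousAlternatingMap.add_apply,
      ContinuousAlternatingMap.smul_apply, smul_eq_mul]
    ring
  -- ### integrability
  -- continuity of the covector fields
  have hDwc : Continuous (fderiv ℝ w) := hwC.continuous_fderiv (by simp)
  have hΨc : Continuous Ψ := hΨ.continuous
  have hdΨc : Continuous (extDeriv Ψ) := by
    have h : extDeriv Ψ = fun x ↦ ContinuousAlternatingMap.alternatizeUncurryFinCLM ℝ E ℝ (fderiv ℝ Ψ x) := by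
      funext x; rfl
    rw [h]
    exact (ContinuousAlternatingMap.alternatizeUncurryFinCLM ℝ E ℝ).continuous.comp
      (hΨ.continuous_fderiv (by simp))
  have hwedge : ∀ m : K → ℤ, Continuous fun y ↦
      wedgeOne E (2 * q + 1) (fderiv ℝ w (ComplexTorus.latticeVecOn Φ K m + y)) (Ψ y) := fun m ↦
    (wedgeOne E (2 * q + 1)).continuous₂.comp
      ((hDwc.comp (continuous_const.add continuous_id)).prodMk hΨc)
  -- `F` on `Q`, hence on the slab
  have hFQ : IntegrableOn F Q μ := T.integrableOn_density_mul_apply_of_isCompact hQc hdΨc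
  have hF_off : ∀ x ∈ D \ Q, F x = 0 := by
    rintro x ⟨hxD, hxQ⟩
    rcases hQ_cases x hxQ with ⟨k, hk, hxk⟩ | h
    · have := hxD k hk
      simp only [Pi.zero_apply, zero_add, mem_Ico] at this
      exact (hxk ⟨by linarith [this.1], by linarith [this.2]⟩).elim
    · simp only [hF, hdΨ0 x h, ContinuousAlternatingMap.coe_zero, Pi.zero_apply, mul_zero]
  have hFD : IntegrableOn F D μ := hFQ.of_forall_sdiff_eq_zero hDm hF_off
  -- `f₂` on `E`
  have hf₂Q : IntegrableOn f₂ Q μ := by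
    have h : IntegrableOn (fun y ↦ (T.density y : ℝ) * (w y • extDeriv Ψ y) (T.orientationFrame y)) Q μ :=
      T.integrableOn_density_mul_apply_of_isCompact hQc (hwC.continuous.smul hdΨc)
    refine h.congr_fun (fun y _ ↦ ?_) hQc.isClosed.measurableSet
    simp only [hf₂, hF, ContinuousAlternatingMap.smul_apply, smul_eq_mul]; ring
  have hf₂_off : ∀ x, x ∉ Q → f₂ x = 0 := by
    intro x hx
    rcases hQ_cases x hx with ⟨k, hk, hxk⟩ | h
    · simp only [hf₂, hw0 x ⟨k, hk, fun h ↦ hxk ⟨by linarith [h.1], by linarith [h.2]⟩⟩, zero_mul]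
    · simp only [hf₂, hF, hdΨ0 x h, ContinuousAlternatingMap.coe_zero, Pi.zero_apply, mul_zero]
  have hf₂i : Integrable f₂ μ := hf₂Q.integrable_of_forall_notMem_eq_zero hf₂_off
  -- `f₁` on `E`
  have hf₁Q : IntegrableOn f₁ Q μ := by
    have h := T.integrableOn_density_mul_apply_of_isCompact hQc (hwedge 0)
    simpa only [map_zero, zero_add] using h
  have hf₁_off : ∀ x, x ∉ Q → f₁ x = 0 := by
    intro x hx
    rcases hQ_cases x hx with ⟨k, hk, hxk⟩ | h
    · simp only [hf₁, hDw0 x ⟨k, hk, fun h ↦ hxk ⟨by linarith [h.1], by linarith [h.2]⟩⟩, map_zero,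
        _root_.zero_apply, ContinuousAlternatingMap.coe_zero, Pi.zero_apply, mul_zero]
    · simp only [hf₁, hΨ0 x h, map_zero, ContinuousAlternatingMap.coe_zero, Pi.zero_apply, mul_zero]
  have hf₁i : Integrable f₁ μ := hf₁Q.integrable_of_forall_notMem_eq_zero hf₁_off
  -- ### `0 = ∫ f₁ + ∫ f₂`
  have hsum : ∫ y, f₁ y ∂μ + ∫ y, f₂ y ∂μ = 0 := by
    rw [← integral_add hf₁i hf₂i, ← h0, hμ]
    exact integral_congr_ae (ae_of_all _ fun y ↦ (hsplit y).symm)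
  -- ### periodicity on the carrier
  have hcar' : ∀ m : K → ℤ, (fun x ↦ ComplexTorus.latticeVecOn Φ K m + x) ⁻¹' T.carrier = T.carrier :=
    fun m ↦ Set.ext fun x ↦ hcar _ x
  have hξ : ∀ (m : K → ℤ) (x : E), T.orientationFrame (ComplexTorus.latticeVecOn Φ K m + x) =
      T.orientationFrame x := fun m x ↦ T.orientationFrame_const_add (hcar' m) x
  have hdΨper : ∀ (m : K → ℤ) (x : E), extDeriv Ψ (ComplexTorus.latticeVecOn Φ K m + x) = extDeriv Ψ x := by
    intro m x
    rw [← extDeriv_comp_add_left Ψ]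
    exact congrArg (fun f ↦ extDeriv f x) (funext (hper m))
  have hdens' : ∀ (m : K → ℤ), ∀ x ∈ T.carrier,
      T.density (ComplexTorus.latticeVecOn Φ K m + x) = T.density x := fun m x hx ↦ hdens _ x hx
  have hFper : ∀ (m : K → ℤ), ∀ x ∈ T.carrier, F (ComplexTorus.latticeVecOn Φ K m + x) = F x := by
    intro m x hx
    simp only [hF, hξ, hdΨper, hdens' m x hx]
  have haeD : ∀ᵐ x ∂(μ.restrict D), x ∈ T.carrier := ae_restrict_of_ae (ae_restrict_mem hcarm)
  have hxD : ∀ x ∈ D, ∀ k ∈ K, Φ.symm x k ∈ Ioo (-1 : ℝ) 2 := fun x hx k hk ↦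
    ComplexTorus.mem_Ioo_of_mem_slab Φ K hx hk
  -- ### the second integral unfolds to `∫_D F`
  have hI₂ : ∫ y, f₂ y ∂μ = ∫ x in D, F x ∂μ := by
    rw [ComplexTorus.integral_eq_sum_setIntegral_slab Φ K hf₂i (ComplexTorus.windowOn K)
      (fun m x hx h ↦ ComplexTorus.mem_windowOn_of_weight_ne_zero Φ K (hxD x hx) (left_ne_zero_of_mul h))]
    -- each term: `∫_D w(Φm + x) F(x)`
    have hterm : ∀ m ∈ ComplexTorus.windowOn K,
        ∫ x in D, f₂ (ComplexTorus.latticeVecOn Φ K m + x) ∂μ =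
          ∫ x in D, w (ComplexTorus.latticeVecOn Φ K m + x) * F x ∂μ := by
      intro m _
      refine integral_congr_ae ?_
      filter_upwards [haeD] with x hx
      simp only [hf₂, hFper m x hx]
    rw [Finset.sum_congr rfl hterm]
    have hint : ∀ m ∈ ComplexTorus.windowOn K,
        Integrable (fun x ↦ w (ComplexTorus.latticeVecOn Φ K m + x) * F x) (μ.restrict D) := fun m _ ↦
      hFD.bdd_mul ((ComplexTorus.contDiff_weight Φ K (n := 0)).continuous.comp
        (continuous_const.add continuous_id)).aestronglyMeasurable
        (ae_of_all _ fun x ↦ by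
          rw [Real.norm_eq_abs]; exact ComplexTorus.abs_weight_le_one Φ K _)
    rw [← integral_finsetSum _ hint]
    refine setIntegral_congr_fun hDm fun x hx ↦ ?_
    rw [← Finset.sum_mul, ComplexTorus.sum_windowOn_weight Φ K (hxD x hx), one_mul]
  -- ### the first integral unfolds to `0`
  have hI₁ : ∫ y, f₁ y ∂μ = 0 := by
    have hG₁ : ∀ (m : K → ℤ), ∀ x ∈ D, f₁ (ComplexTorus.latticeVecOn Φ K m + x) ≠ 0 →
        m ∈ ComplexTorus.windowOn K := by
      intro m x hx h
      rw [ComplexTorus.windowOn, Fintype.mem_piFinset]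
      intro k
      -- `Dw(Φm + x) ≠ 0`, so `(Φm + x)_k ∈ [0, 2]`
      have hne : fderiv ℝ w (ComplexTorus.latticeVecOn Φ K m + x) ≠ 0 := by
        intro h0'
        apply h
        simp only [hf₁, h0', map_zero, _root_.zero_apply, ContinuousAlternatingMap.coe_zero, Pi.zero_apply,
          mul_zero]
      have hk := k.2
      have hmem : Φ.symm (ComplexTorus.latticeVecOn Φ K m + x) k ∈ Icc (0 : ℝ) 2 := by
        by_contra hc
        exact hne (hDw0 _ ⟨k, hk, hc⟩)
      rw [map_add, Pi.add_apply, ComplexTorus.symm_latticeVecOn_apply_of_mem Φ K m hk] at hmem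
      have hxk := hx k hk
      simp only [Pi.zero_apply, zero_add, mem_Ico] at hxk
      have h1 : (-2 : ℝ) < m k := by linarith [hmem.1, hxk.2]
      have h2 : (m k : ℝ) < 3 := by linarith [hmem.2, hxk.1]
      exact ComplexTorus.mem_window_of_lt_of_lt (by exact_mod_cast h1) (by exact_mod_cast h2)
    rw [ComplexTorus.integral_eq_sum_setIntegral_slab Φ K hf₁i (ComplexTorus.windowOn K) hG₁]
    -- each term: `∫_D θ ⟨Dw(Φm + x) ∧ Ψ x, ξ x⟩`
    set g : (K → ℤ) → E → ℝ := fun m x ↦ (T.density x : ℝ) *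
      (wedgeOne E (2 * q + 1) (fderiv ℝ w (ComplexTorus.latticeVecOn Φ K m + x)) (Ψ x))
        (T.orientationFrame x) with hg
    have hterm : ∀ m ∈ ComplexTorus.windowOn K,
        ∫ x in D, f₁ (ComplexTorus.latticeVecOn Φ K m + x) ∂μ = ∫ x in D, g m x ∂μ := by
      intro m _
      refine integral_congr_ae ?_
      filter_upwards [haeD] with x hx
      simp only [hf₁, hg, hξ, hper, hdens' m x hx]
    rw [Finset.sum_congr rfl hterm]
    have hint : ∀ m ∈ ComplexTorus.windowOn K, Integrable (g m) (μ.restrict D) := by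
      intro m _
      have hgQ : IntegrableOn (g m) Q μ := T.integrableOn_density_mul_apply_of_isCompact hQc (hwedge m)
      refine hgQ.of_forall_sdiff_eq_zero hDm ?_
      rintro x ⟨hxD', hxQ⟩
      rcases hQ_cases x hxQ with ⟨k, hk, hxk⟩ | h
      · have := hxD' k hk
        simp only [Pi.zero_apply, zero_add, mem_Ico] at this
        exact (hxk ⟨by linarith [this.1], by linarith [this.2]⟩).elim
      · simp only [hg, hΨ0 x h, map_zero, ContinuousAlternatingMap.coe_zero, Pi.zero_apply, mul_zero]
    rw [← integral_finsetSum _ hint]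
    refine (setIntegral_congr_fun hDm fun x hx ↦ ?_).trans (integral_zero E ℝ)
    simp only [hg]
    rw [← Finset.mul_sum, ← ContinuousAlternatingMap.sum_apply, ← _root_.sum_apply, ← map_sum,
      show (∑ m ∈ ComplexTorus.windowOn K, fderiv ℝ w (ComplexTorus.latticeVecOn Φ K m + x)) = 0 from
        ComplexTorus.sum_windowOn_fderiv_weight_eq_zero Φ K hx,
      map_zero, _root_.zero_apply, ContinuousAlternatingMap.coe_zero, Pi.zero_apply, mul_zero]
  -- ### conclusion
  rw [← hI₂]
  linarith [hsum, hI₁]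

end Stokes

end HolomorphicChain

end Literature.Geometry.Kaehler

end
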